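import Summits.Schanuel.Schanuel.Theses.RigidCore
import Literature.NumberTheory.Transcendental.ExpPointsExamples
import Literature.NumberTheory.Transcendental.ExpPointsCoordinateChange
import Literature.NumberTheory.Transcendental.ExpPointsGeometryBasic
import Literature.NumberTheory.Transcendental.RationalCoordRelations
import Summits.Schanuel.Schanuel.Theorems.RigidCoreSparsityTwoTaylorLogCoeffsAlgebraic
import Summits.Schanuel.Schanuel.Theorems.RigidCoreSparsityTwoMixedPeriodPocket
import Summits.Schanuel.Schanuel.Theorems.RigidCoreSparsityTwoSplitSlope
import Summits.Schanuel.Schanuel.Theorems.RigidCoreSparsityTwoSplitLinear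

/-!
# The split of `RigidCore.SparsityTwo`, part 4: `★⁺ ⇐ atoms + pockets`

Line `cusp-germ-schneider-sparsity` of the crux `RigidCore.SparsityTwo` (item stmt-Schanuel-0971), lead gens 1/c1/c2.
`rayHits_finite_of_split'`: the residual statement (★) of the line — a normalised log-free cusp ray of a `ℚ`-closed
`W ⊆ ℂ² × ℂ²` of dimension `< 2` with transcendental tail, non-`q(N)+c` real jet and lacunary hits — TOGETHER WITH
the algebraic uniformisation `(N₀, T, ℓ₀, ℓ₁, Φ₁, r)` of `stub_cuspEscapeAlg`, has finitely many ray hits, GIVEN the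
three open atoms A3 (`stub_wildCuspAtom`), A2 (`stub_inhomogeneousCuspAtom`), A1 (`stub_linearCuspAtom`) at this
cusp (hypotheses `hA3`, `hA2`, `hA1`: the registered atom statements applied up to the linking identities) and the
deep pocket (hypothesis `hDeep`, the registered statement of the landed `stub_deepCuspFinite`, p87226, whose hub
module is not built yet); the Roth pocket (p97601), the mixed-period pocket (p102273) and the arithmetic normal form
(ANF, `stub_taylorLogCoeffsAlgebraic`) are imported.

Steps: (1) the permuted `ℚ`-curve `W' = {z | z ∘ (s ⊕ s) ∈ W}` contains the `t`-branch, so every pair of branch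
coordinates satisfies a non-zero rational relation (`exists_rat_relation_pair_of_zariskiDim_lt_two`); (2) ANF: the
Taylor coefficients of `Φ₁`, the cusp values `e^{ℓⱼ 0}` and the positive-order coefficients of `ℓⱼ` are algebraic;
(3) the ray points `σ_N → 0` and the additive coordinates of the ray point are the branch coordinates at `T σ_N`,
so `R₃(x N) = 0` at every late ray point; (4) CONSTANT exponential coordinates: both cusp values torsion ⇒ every
late hit is ℚ-dependent (`not_linearIndependent_torsion_translate`), else the mixed period pocket on `R₃ = 0`;
(5) non-constant: a non-linear jet is atom A3; a linear jet `Φ₁ t/t^{N₀} = β t⁻ᵉ + G t` has `A = β X^e + a₀`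
(`linearJet_normalForm`), so `β = A.coeff e` is algebraic (`cusp_slope_isAlgebraic_of_eq_linearJet`, the only use of
`W` in step 5) and `rayHits_finite_linearJet` (part 3) finishes. No unproved facts; axioms standard.
-/

set_option linter.dupNamespace false

namespace Summit.Schanuel.Schanuel.Cruxes.SparsityTwo.CuspGermSchneiderSparsity

open Filter Topology Complex Polynomial Literature.NumberTheory.Transcendental
open scoped Real

/-- **Constant exponential coordinates along the ray: finitely many independent hits** (Step 4 of the split, the file's
registered anchor). If `ℓu σ_N = l₀` and `ℓv σ_N = l₁` at all late ray points, `e^{l₀}, e^{l₁} ∈ ℚ̄`, and the ray points satisfy a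
non-zero rational relation `R₃(x N) = 0` eventually, then only finitely many ray hits are ℚ-linearly independent: with both cusp
values torsion every late hit `(l₀ + 2πi N, l₁ + 2πi L)` is ℚ-dependent (`not_linearIndependent_torsion_translate`), otherwise the
mixed period pocket (`stub_mixedPeriodPocket`, p102273) bounds the independent lattice translates on `R₃ = 0`. -/
theorem rayHits_finite_of_constLogs :
    ∀ (e : ℕ) (A : Polynomial ℂ) (g ℓu ℓv : ℂ → ℂ) (l₀ l₁ : ℂ) (R₃ : MvPolynomial (Fin 2) ℚ),
      let w : ℕ → ℂ := fun N => (((N : ℝ) ^ ((e : ℝ)⁻¹) : ℝ) : ℂ);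
      let x' : ℕ → Fin 2 → ℂ := fun N =>
        ![2 * ↑π * I * (N : ℂ) + ℓu (w N)⁻¹, 2 * ↑π * I * (A.eval (w N) + g (w N)⁻¹) + ℓv (w N)⁻¹];
      (∀ᶠ N : ℕ in atTop, ℓu (w N)⁻¹ = l₀ ∧ ℓv (w N)⁻¹ = l₁) →
      IsAlgebraic ℚ (Complex.exp l₀) → IsAlgebraic ℚ (Complex.exp l₁) → R₃ ≠ 0 →
      (∀ᶠ N : ℕ in atTop, MvPolynomial.aeval (x' N) R₃ = 0) →
      Set.Finite {N : ℕ | LinearIndependent ℚ (x' N) ∧ ∃ L : ℤ, A.eval (w N) + g (w N)⁻¹ = L} := by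
  intro e A g ℓu ℓv l₀ l₁ R₃ w x' hℓconst hα₀ hα₁ hR₃0 hR₃x
  have hfin_of_eventually : ∀ {P : ℕ → Prop}, (∀ᶠ N in atTop, P N) → Set.Finite {N | ¬ P N} := by
    intro P hP
    rwa [← Nat.cofinite_eq_atTop, Filter.eventually_cofinite] at hP
  -- at a late hit `L`, the ray point is the lattice translate `(l₀ + 2πi N, l₁ + 2πi L)`
  have hxhit : ∀ᶠ N : ℕ in atTop, ∀ L : ℤ, A.eval (w N) + g (w N)⁻¹ = L →
      x' N = ![l₀ + 2 * ↑π * I * ((N : ℤ) : ℂ), l₁ + 2 * ↑π * I * (L : ℂ)] := by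
    filter_upwards [hℓconst] with N hN L hL
    funext i; fin_cases i
    · simp [x', hN.1]; ring
    · simp [x', hN.2, hL]; ring
  by_cases htor : ∃ q : ℕ, 0 < q ∧ Complex.exp l₀ ^ q = 1 ∧ Complex.exp l₁ ^ q = 1
  · -- both cusp values torsion: every late hit is ℚ-dependent
    obtain ⟨q, hq, hq0, hq1⟩ := htor
    obtain ⟨m₀, hm₀⟩ : ∃ m₀ : ℤ, (q : ℂ) * l₀ = m₀ * (2 * ↑π * I) :=
      Complex.exp_eq_one_iff.mp (by rw [Complex.exp_nat_mul]; exact hq0)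
    obtain ⟨m₁, hm₁⟩ : ∃ m₁ : ℤ, (q : ℂ) * l₁ = m₁ * (2 * ↑π * I) :=
      Complex.exp_eq_one_iff.mp (by rw [Complex.exp_nat_mul]; exact hq1)
    have hlarge : ∀ᶠ N : ℕ in atTop, (q : ℤ) * N + m₀ ≠ 0 := by
      have h1 : Tendsto (fun N : ℕ => (q : ℤ) * N + m₀) atTop atTop :=
        tendsto_atTop_add_const_right _ _
          (Tendsto.const_mul_atTop' (by exact_mod_cast hq) tendsto_natCast_atTop_atTop)
      exact (h1.eventually_gt_atTop 0).mono fun N hN => hN.ne'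
    refine (hfin_of_eventually (hxhit.and hlarge)).subset ?_
    rintro N ⟨hind, L, hL⟩ ⟨hNx, hNq⟩
    rw [hNx L hL] at hind
    exact not_linearIndependent_torsion_translate hq hm₀ hm₁ hNq hind
  · -- not both torsion: the mixed period pocket on the relation `R₃(x₁, x₂) = 0`
    have hF := stub_mixedPeriodPocket l₀ l₁ hα₀ hα₁ htor R₃ hR₃0
    refine ((hfin_of_eventually (hxhit.and hR₃x)).union
      (hF.image fun p : ℤ × ℤ => p.1.toNat)).subset ?_
    rintro N ⟨hind, L, hL⟩
    by_cases hP : (∀ L : ℤ, A.eval (w N) + g (w N)⁻¹ = L →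
        x' N = ![l₀ + 2 * ↑π * I * ((N : ℤ) : ℂ), l₁ + 2 * ↑π * I * (L : ℂ)]) ∧
        MvPolynomial.aeval (x' N) R₃ = 0
    · refine Or.inr ⟨((N : ℤ), L), ⟨?_, ?_⟩, by simp⟩
      · rw [← hP.1 L hL]; exact hind
      · rw [← hP.1 L hL]; exact hP.2
    · exact Or.inl hP

/-- **The split `★⁺ ⇐ atoms + pockets`** (see the module docstring): finitely many ray hits at a normalised
log-free cusp of a `ℚ`-closed `W` of dimension `< 2` with algebraic uniformisation, given the deep pocket and the
three atoms at this cusp. -/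
theorem rayHits_finite_of_split' :
    ∀ (W : Set (Fin 2 ⊕ Fin 2 → ℂ)), IsDefinedOver (⊥ : Subfield ℂ) W → zariskiDim ℂ W < 2 →
      ∀ (s : Fin 2 ≃ Fin 2) (e : ℕ) (A : Polynomial ℂ) (g ℓu ℓv : ℂ → ℂ) (ρ : ℝ)
        (N₀ : ℕ) (T ℓ₀ ℓ₁ Φ₁ : ℂ → ℂ) (r : ℝ),
        let w : ℕ → ℂ := fun N => (((N : ℝ) ^ ((e : ℝ)⁻¹) : ℝ) : ℂ);
        let x' : ℕ → Fin 2 → ℂ := fun N =>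
          ![2 * ↑π * I * (N : ℂ) + ℓu (w N)⁻¹, 2 * ↑π * I * (A.eval (w N) + g (w N)⁻¹) + ℓv (w N)⁻¹];
        let x : ℕ → Fin 2 → ℂ := fun N => x' N ∘ s;
        let y : ℕ → Fin 2 → ℂ := fun N =>
          (![Complex.exp (ℓu (w N)⁻¹), Complex.exp (ℓv (w N)⁻¹)] : Fin 2 → ℂ) ∘ s;
        0 < e → 0 < ρ → AnalyticAt ℂ g 0 → g 0 = 0 → AnalyticAt ℂ ℓu 0 → AnalyticAt ℂ ℓv 0 →
        (¬ ∃ P : MvPolynomial (Fin 2) ℂ, P ≠ 0 ∧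
            ∀ᶠ z in 𝓝 (0 : ℂ), MvPolynomial.eval ![z, g z] P = 0) →
        (∀ σ : ℂ, 0 < ‖σ‖ → ‖σ‖ < ρ →
          Sum.elim ((![2 * ↑π * I * σ⁻¹ ^ e + ℓu σ,
                        2 * ↑π * I * (A.eval σ⁻¹ + g σ) + ℓv σ] : Fin 2 → ℂ) ∘ s)
            ((![Complex.exp (ℓu σ), Complex.exp (ℓv σ)] : Fin 2 → ℂ) ∘ s) ∈ W) →
        (¬ ∃ (q : Polynomial ℚ) (c : ℂ), ∀ N : ℕ,
            A.eval (w N) = (q.map (algebraMap ℚ ℂ)).eval (N : ℂ) + c) →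
        ((∀ k : ℕ, (A.coeff k).im = 0) ∧ ∀ᶠ t : ℝ in 𝓝[>] 0, (g (t : ℂ)).im = 0) →
        0 < r → AnalyticAt ℂ T 0 → T 0 = 0 → AnalyticAt ℂ ℓ₀ 0 → AnalyticAt ℂ ℓ₁ 0 → AnalyticAt ℂ Φ₁ 0 →
        (∀ t : ℂ, 0 < ‖t‖ → ‖t‖ < r →
          Sum.elim ((![(t ^ e)⁻¹, Φ₁ t / t ^ N₀] : Fin 2 → ℂ) ∘ s)
            ((![Complex.exp (ℓ₀ t), Complex.exp (ℓ₁ t)] : Fin 2 → ℂ) ∘ s) ∈ W) →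
        (∀ σ : ℂ, 0 < ‖σ‖ → ‖σ‖ < ρ → 0 < ‖T σ‖ ∧ ‖T σ‖ < r ∧
          ((T σ) ^ e)⁻¹ = 2 * ↑π * I * σ⁻¹ ^ e + ℓu σ ∧
          Φ₁ (T σ) / (T σ) ^ N₀ = 2 * ↑π * I * (A.eval σ⁻¹ + g σ) + ℓv σ ∧
          ℓ₀ (T σ) = ℓu σ ∧ ℓ₁ (T σ) = ℓv σ) →
        (∀ (e q : ℕ) (m₁ : ℤ) (β : ℂ) (Φ : ℂ → ℂ) (t c : ℕ → ℂ) (lam : ℂ),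
          0 < e → 0 < q → β.im = 0 → IsAlgebraic ℚ β →
          AnalyticAt ℂ Φ 0 → Φ 0 = 0 → (¬ ∀ᶠ z in 𝓝 (0 : ℂ), Φ z = 0) →
          (∀ n : ℕ, IsAlgebraic ℚ (iteratedDeriv n Φ 0)) →
          (∀ j : ℕ, j < e * ((minpoly ℚ β).natDegree - 1) → iteratedDeriv j Φ 0 = 0) →
          Tendsto t atTop (𝓝 0) → Tendsto c atTop (𝓝 lam) →
          (∀ᶠ n : ℕ in atTop, t n ≠ 0 ∧ ((t n) ^ e)⁻¹ = 2 * ↑π * I * (n : ℂ) + c n) →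
          Set.Finite {n : ℕ | ∃ L : ℤ,
            β * ((q : ℂ) * (n : ℂ) + (m₁ : ℂ)) + (q : ℂ) * Φ (t n) / (2 * ↑π * I) = L}) →
        ((∃ W' : Set (Fin 2 ⊕ Fin 2 → ℂ), IsDefinedOver (⊥ : Subfield ℂ) W' ∧ zariskiDim ℂ W' < 2 ∧
            ∀ t : ℂ, 0 < ‖t‖ → ‖t‖ < r →
              Sum.elim (![(t ^ e)⁻¹, Φ₁ t / t ^ N₀] : Fin 2 → ℂ)
                (![Complex.exp (ℓ₀ t), Complex.exp (ℓ₁ t)] : Fin 2 → ℂ) ∈ W') →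
          (∃ R : MvPolynomial (Fin 2) ℚ, R ≠ 0 ∧ ∀ t : ℂ, 0 < ‖t‖ → ‖t‖ < r →
            MvPolynomial.aeval ![(t ^ e)⁻¹, Complex.exp (ℓ₀ t)] R = 0) →
          (∃ R : MvPolynomial (Fin 2) ℚ, R ≠ 0 ∧ ∀ t : ℂ, 0 < ‖t‖ → ‖t‖ < r →
            MvPolynomial.aeval ![(t ^ e)⁻¹, Complex.exp (ℓ₁ t)] R = 0) →
          (∃ R : MvPolynomial (Fin 2) ℚ, R ≠ 0 ∧ ∀ t : ℂ, 0 < ‖t‖ → ‖t‖ < r →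
            MvPolynomial.aeval ![(t ^ e)⁻¹, Φ₁ t / t ^ N₀] R = 0) →
          (∃ R : MvPolynomial (Fin 2) ℚ, R ≠ 0 ∧ ∀ t : ℂ, 0 < ‖t‖ → ‖t‖ < r →
            MvPolynomial.aeval ![Φ₁ t / t ^ N₀, Complex.exp (ℓ₀ t)] R = 0) →
          (∃ R : MvPolynomial (Fin 2) ℚ, R ≠ 0 ∧ ∀ t : ℂ, 0 < ‖t‖ → ‖t‖ < r →
            MvPolynomial.aeval ![Φ₁ t / t ^ N₀, Complex.exp (ℓ₁ t)] R = 0) →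
          (∃ R : MvPolynomial (Fin 2) ℚ, R ≠ 0 ∧ ∀ t : ℂ, 0 < ‖t‖ → ‖t‖ < r →
            MvPolynomial.aeval ![Complex.exp (ℓ₀ t), Complex.exp (ℓ₁ t)] R = 0) →
          (∀ n : ℕ, IsAlgebraic ℚ (iteratedDeriv n Φ₁ 0)) →
          IsAlgebraic ℚ (Complex.exp (ℓ₀ 0)) → IsAlgebraic ℚ (Complex.exp (ℓ₁ 0)) →
          (∀ n : ℕ, 0 < n → IsAlgebraic ℚ (iteratedDeriv n ℓ₀ 0)) →
          (∀ n : ℕ, 0 < n → IsAlgebraic ℚ (iteratedDeriv n ℓ₁ 0)) →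
          (¬ ∃ (β : ℂ) (G : ℂ → ℂ), AnalyticAt ℂ G 0 ∧
              ∀ t : ℂ, 0 < ‖t‖ → ‖t‖ < r → Φ₁ t / t ^ N₀ = β * (t ^ e)⁻¹ + G t) →
          (¬ ∀ᶠ t in 𝓝 (0 : ℂ), ℓ₀ t = ℓ₀ 0 ∧ ℓ₁ t = ℓ₁ 0) →
          Set.Finite {n : ℕ | LinearIndependent ℚ (x' n) ∧ ∃ L : ℤ, A.eval (w n) + g (w n)⁻¹ = L}) →
        (∀ (G : ℂ → ℂ) (β : ℂ),
          (∃ W' : Set (Fin 2 ⊕ Fin 2 → ℂ), IsDefinedOver (⊥ : Subfield ℂ) W' ∧ zariskiDim ℂ W' < 2 ∧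
            ∀ t : ℂ, 0 < ‖t‖ → ‖t‖ < r →
              Sum.elim (![(t ^ e)⁻¹, Φ₁ t / t ^ N₀] : Fin 2 → ℂ)
                (![Complex.exp (ℓ₀ t), Complex.exp (ℓ₁ t)] : Fin 2 → ℂ) ∈ W') →
          (∃ R : MvPolynomial (Fin 2) ℚ, R ≠ 0 ∧ ∀ t : ℂ, 0 < ‖t‖ → ‖t‖ < r →
            MvPolynomial.aeval ![(t ^ e)⁻¹, Complex.exp (ℓ₀ t)] R = 0) →
          (∃ R : MvPolynomial (Fin 2) ℚ, R ≠ 0 ∧ ∀ t : ℂ, 0 < ‖t‖ → ‖t‖ < r →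
            MvPolynomial.aeval ![(t ^ e)⁻¹, Complex.exp (ℓ₁ t)] R = 0) →
          (∃ R : MvPolynomial (Fin 2) ℚ, R ≠ 0 ∧ ∀ t : ℂ, 0 < ‖t‖ → ‖t‖ < r →
            MvPolynomial.aeval ![(t ^ e)⁻¹, Φ₁ t / t ^ N₀] R = 0) →
          (∃ R : MvPolynomial (Fin 2) ℚ, R ≠ 0 ∧ ∀ t : ℂ, 0 < ‖t‖ → ‖t‖ < r →
            MvPolynomial.aeval ![Φ₁ t / t ^ N₀, Complex.exp (ℓ₀ t)] R = 0) →
          (∃ R : MvPolynomial (Fin 2) ℚ, R ≠ 0 ∧ ∀ t : ℂ, 0 < ‖t‖ → ‖t‖ < r →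
            MvPolynomial.aeval ![Φ₁ t / t ^ N₀, Complex.exp (ℓ₁ t)] R = 0) →
          (∃ R : MvPolynomial (Fin 2) ℚ, R ≠ 0 ∧ ∀ t : ℂ, 0 < ‖t‖ → ‖t‖ < r →
            MvPolynomial.aeval ![Complex.exp (ℓ₀ t), Complex.exp (ℓ₁ t)] R = 0) →
          (∀ n : ℕ, IsAlgebraic ℚ (iteratedDeriv n Φ₁ 0)) →
          IsAlgebraic ℚ (Complex.exp (ℓ₀ 0)) → IsAlgebraic ℚ (Complex.exp (ℓ₁ 0)) →
          (∀ n : ℕ, 0 < n → IsAlgebraic ℚ (iteratedDeriv n ℓ₀ 0)) →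
          (∀ n : ℕ, 0 < n → IsAlgebraic ℚ (iteratedDeriv n ℓ₁ 0)) →
          AnalyticAt ℂ G 0 → (∀ t : ℂ, 0 < ‖t‖ → ‖t‖ < r → Φ₁ t / t ^ N₀ = β * (t ^ e)⁻¹ + G t) →
          IsAlgebraic ℚ β → (∀ n : ℕ, IsAlgebraic ℚ (iteratedDeriv n G 0)) →
          (∀ r' : ℚ, (r' : ℂ) ≠ β) →
          (¬ ∀ᶠ t in 𝓝 (0 : ℂ), ℓ₀ t = ℓ₀ 0 ∧ ℓ₁ t = ℓ₁ 0) →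
          ((∃ q : ℕ, 0 < q ∧ Complex.exp (ℓ₀ 0) ^ q = 1 ∧ Complex.exp (ℓ₁ 0) ^ q = 1) → G 0 ≠ 0) →
          Set.Finite {n : ℕ | LinearIndependent ℚ (x' n) ∧ ∃ L : ℤ, A.eval (w n) + g (w n)⁻¹ = L}) →
        (∀ (G : ℂ → ℂ) (β : ℂ) (q : ℕ) (m₀ m₁ : ℤ),
          (∃ W' : Set (Fin 2 ⊕ Fin 2 → ℂ), IsDefinedOver (⊥ : Subfield ℂ) W' ∧ zariskiDim ℂ W' < 2 ∧
            ∀ t : ℂ, 0 < ‖t‖ → ‖t‖ < r →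
              Sum.elim (![(t ^ e)⁻¹, Φ₁ t / t ^ N₀] : Fin 2 → ℂ)
                (![Complex.exp (ℓ₀ t), Complex.exp (ℓ₁ t)] : Fin 2 → ℂ) ∈ W') →
          (∃ R : MvPolynomial (Fin 2) ℚ, R ≠ 0 ∧ ∀ t : ℂ, 0 < ‖t‖ → ‖t‖ < r →
            MvPolynomial.aeval ![(t ^ e)⁻¹, Complex.exp (ℓ₀ t)] R = 0) →
          (∃ R : MvPolynomial (Fin 2) ℚ, R ≠ 0 ∧ ∀ t : ℂ, 0 < ‖t‖ → ‖t‖ < r →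
            MvPolynomial.aeval ![(t ^ e)⁻¹, Complex.exp (ℓ₁ t)] R = 0) →
          (∃ R : MvPolynomial (Fin 2) ℚ, R ≠ 0 ∧ ∀ t : ℂ, 0 < ‖t‖ → ‖t‖ < r →
            MvPolynomial.aeval ![(t ^ e)⁻¹, Φ₁ t / t ^ N₀] R = 0) →
          (∃ R : MvPolynomial (Fin 2) ℚ, R ≠ 0 ∧ ∀ t : ℂ, 0 < ‖t‖ → ‖t‖ < r →
            MvPolynomial.aeval ![Φ₁ t / t ^ N₀, Complex.exp (ℓ₀ t)] R = 0) →
          (∃ R : MvPolynomial (Fin 2) ℚ, R ≠ 0 ∧ ∀ t : ℂ, 0 < ‖t‖ → ‖t‖ < r →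
            MvPolynomial.aeval ![Φ₁ t / t ^ N₀, Complex.exp (ℓ₁ t)] R = 0) →
          (∃ R : MvPolynomial (Fin 2) ℚ, R ≠ 0 ∧ ∀ t : ℂ, 0 < ‖t‖ → ‖t‖ < r →
            MvPolynomial.aeval ![Complex.exp (ℓ₀ t), Complex.exp (ℓ₁ t)] R = 0) →
          (∀ n : ℕ, IsAlgebraic ℚ (iteratedDeriv n Φ₁ 0)) →
          IsAlgebraic ℚ (Complex.exp (ℓ₀ 0)) → IsAlgebraic ℚ (Complex.exp (ℓ₁ 0)) →
          (∀ n : ℕ, 0 < n → IsAlgebraic ℚ (iteratedDeriv n ℓ₀ 0)) →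
          (∀ n : ℕ, 0 < n → IsAlgebraic ℚ (iteratedDeriv n ℓ₁ 0)) →
          AnalyticAt ℂ G 0 → (∀ t : ℂ, 0 < ‖t‖ → ‖t‖ < r → Φ₁ t / t ^ N₀ = β * (t ^ e)⁻¹ + G t) →
          IsAlgebraic ℚ β → (∀ n : ℕ, IsAlgebraic ℚ (iteratedDeriv n G 0)) →
          (∀ r' : ℚ, (r' : ℂ) ≠ β) →
          β.im = 0 → 0 < q → (q : ℂ) * ℓ₀ 0 = 2 * ↑π * I * (m₀ : ℂ) → (q : ℂ) * ℓ₁ 0 = 2 * ↑π * I * (m₁ : ℂ) →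
          G 0 = 0 →
          (¬ ∀ᶠ t in 𝓝 (0 : ℂ), ℓ₀ t = ℓ₀ 0 ∧ ℓ₁ t = ℓ₁ 0) →
          (∃ j : ℕ, j ≤ e ∧ j < e * ((minpoly ℚ β).natDegree - 1) ∧
            (∀ i : ℕ, i < j → iteratedDeriv i (fun t => β * (ℓ₀ t - ℓ₀ 0) - (ℓ₁ t - ℓ₁ 0) + G t) 0 = 0) ∧
            iteratedDeriv j (fun t => β * (ℓ₀ t - ℓ₀ 0) - (ℓ₁ t - ℓ₁ 0) + G t) 0 ≠ 0) →
          Set.Finite {n : ℕ | LinearIndependent ℚ (x' n) ∧ ∃ L : ℤ, A.eval (w n) + g (w n)⁻¹ = L}) →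
        Set.Finite {N : ℕ | x N ∈ indepExpPoints W ∧ Complex.exp ∘ x N = y N ∧
          ∃ L : ℤ, A.eval (w N) + g (w N)⁻¹ = L} := by
  intro W hW hdim s e A g ℓu ℓv ρ N₀ T ℓ₀ ℓ₁ Φ₁ r w x' x y he hρ hg hg0 hu hv htr hbr hrat hreal
    hr hT hT0 h₀ h₁ hΦ₁ hbr' hlink hDeep hA3 hA2 hA1
  /- ### Step 0: notation-free restatements -/
  have hxx' : ∀ N, x N = x' N ∘ s := fun N => rfl
  have hw_pow : ∀ N : ℕ, (w N) ^ e = (N : ℂ) := fun N => rayAbscissa_pow he N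
  have hw_inv_pow : ∀ N : ℕ, ((w N)⁻¹)⁻¹ ^ e = (N : ℂ) := fun N => by rw [inv_inv, hw_pow]
  -- it suffices to bound the W-free hit set
  suffices hfin : Set.Finite {N : ℕ | LinearIndependent ℚ (x' N) ∧
      ∃ L : ℤ, A.eval (w N) + g (w N)⁻¹ = L} by
    refine hfin.subset ?_
    rintro N ⟨hmem, -, hL⟩
    refine ⟨?_, hL⟩
    have h1 := (mem_indepExpPoints_iff.mp hmem).1
    rw [hxx'] at h1
    exact (linearIndependent_equiv s).mp h1
  /- ### Step 1: the permuted variety `W'` and the six rational relations along the `t`-branch -/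
  set τ : (Fin 2 ⊕ Fin 2) ≃ (Fin 2 ⊕ Fin 2) := Equiv.sumCongr s s with hτ
  set W' : Set (Fin 2 ⊕ Fin 2 → ℂ) := {z | z ∘ τ ∈ W} with hW'def
  have hW' : IsDefinedOver (⊥ : Subfield ℂ) W' := isDefinedOver_comp_equiv hW τ
  have hdim' : zariskiDim ℂ W' < 2 := by rw [hW'def, zariskiDim_comp_equiv W τ]; exact hdim
  have hbrW' : ∀ t : ℂ, 0 < ‖t‖ → ‖t‖ < r →
      Sum.elim (![(t ^ e)⁻¹, Φ₁ t / t ^ N₀] : Fin 2 → ℂ)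
        (![Complex.exp (ℓ₀ t), Complex.exp (ℓ₁ t)] : Fin 2 → ℂ) ∈ W' := by
    intro t ht0 htr'
    show _ ∘ τ ∈ W
    rw [hτ, sumElim_comp_sumCongr]
    exact hbr' t ht0 htr'
  -- a rational relation between two named coordinates of the branch
  have hrel : ∀ p q : Fin 2 ⊕ Fin 2, ∃ R : MvPolynomial (Fin 2) ℚ, R ≠ 0 ∧
      ∀ t : ℂ, 0 < ‖t‖ → ‖t‖ < r →
        MvPolynomial.aeval ![(Sum.elim (![(t ^ e)⁻¹, Φ₁ t / t ^ N₀] : Fin 2 → ℂ)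
            (![Complex.exp (ℓ₀ t), Complex.exp (ℓ₁ t)] : Fin 2 → ℂ)) p,
          (Sum.elim (![(t ^ e)⁻¹, Φ₁ t / t ^ N₀] : Fin 2 → ℂ)
            (![Complex.exp (ℓ₀ t), Complex.exp (ℓ₁ t)] : Fin 2 → ℂ)) q] R = 0 := by
    intro p q
    obtain ⟨R, hR0, hRW⟩ := exists_rat_relation_pair_of_zariskiDim_lt_two W' hW' hdim' p q
    exact ⟨R, hR0, fun t ht0 htr' => hRW _ (hbrW' t ht0 htr')⟩
  obtain ⟨R₁, hR₁0, hR₁⟩ := hrel (Sum.inl 0) (Sum.inr 0)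
  obtain ⟨R₂, hR₂0, hR₂⟩ := hrel (Sum.inl 0) (Sum.inr 1)
  obtain ⟨R₃, hR₃0, hR₃⟩ := hrel (Sum.inl 0) (Sum.inl 1)
  obtain ⟨R₄, hR₄0, hR₄⟩ := hrel (Sum.inl 1) (Sum.inr 0)
  obtain ⟨R₅, hR₅0, hR₅⟩ := hrel (Sum.inl 1) (Sum.inr 1)
  obtain ⟨R₆, hR₆0, hR₆⟩ := hrel (Sum.inr 0) (Sum.inr 1)
  simp only [Sum.elim_inl, Sum.elim_inr, Matrix.cons_val_zero, Matrix.cons_val_one]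
    at hR₁ hR₂ hR₃ hR₄ hR₅ hR₆
  /- ### Step 2: the arithmetic normal form (ANF) -/
  have hnbd : ∀ {R : MvPolynomial (Fin 2) ℚ} {a b : ℂ → ℂ},
      (∀ t : ℂ, 0 < ‖t‖ → ‖t‖ < r → MvPolynomial.aeval ![a t, b t] R = 0) →
      ∀ᶠ t in 𝓝[≠] (0 : ℂ),
        MvPolynomial.eval ![a t, b t] (MvPolynomial.map (algebraMap ℚ ℂ) R) = 0 := by
    intro R a b h
    filter_upwards [puncturedDisc_mem_nhdsNE hr] with t ht
    rw [MvPolynomial.eval_map, ← MvPolynomial.aeval_def]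
    exact h t ht.1 ht.2
  have hmap0 : ∀ {R : MvPolynomial (Fin 2) ℚ}, R ≠ 0 →
      MvPolynomial.map (algebraMap ℚ ℂ) R ≠ 0 := fun hR h =>
    hR (MvPolynomial.map_injective _ (algebraMap ℚ ℂ).injective (by rw [h, map_zero]))
  have hmapalg : ∀ (R : MvPolynomial (Fin 2) ℚ) (m : Fin 2 →₀ ℕ),
      IsAlgebraic ℚ ((MvPolynomial.map (algebraMap ℚ ℂ) R).coeff m) := fun R m => by
    rw [MvPolynomial.coeff_map]; exact isAlgebraic_algebraMap _
  have hΦ₁alg : ∀ n : ℕ, IsAlgebraic ℚ (iteratedDeriv n Φ₁ 0) :=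
    stub_taylorLogCoeffsAlgebraic.1 Φ₁ e N₀ _ he hΦ₁ (hmap0 hR₃0) (hmapalg R₃) (hnbd hR₃)
  obtain ⟨hα₀, hℓ₀alg⟩ :=
    stub_taylorLogCoeffsAlgebraic.2 ℓ₀ e _ he h₀ (hmap0 hR₁0) (hmapalg R₁) (hnbd hR₁)
  obtain ⟨hα₁, hℓ₁alg⟩ :=
    stub_taylorLogCoeffsAlgebraic.2 ℓ₁ e _ he h₁ (hmap0 hR₂0) (hmapalg R₂) (hnbd hR₂)
  /- ### Step 3: the ray points `σ_N = (w N)⁻¹` and the uniformiser values `T σ_N` -/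
  have hσmem : ∀ᶠ N : ℕ in atTop, 0 < ‖(w N)⁻¹‖ ∧ ‖(w N)⁻¹‖ < ρ :=
    eventually_rayPoint_mem_puncturedDisc he hρ
  have hσlim : Tendsto (fun N => (w N)⁻¹) atTop (𝓝 0) :=
    (tendsto_rayPoint_nhdsNE he).mono_right nhdsWithin_le_nhds
  have htlim : Tendsto (fun N => T (w N)⁻¹) atTop (𝓝 0) := by
    have h := (hT.continuousAt.tendsto).comp hσlim
    rwa [hT0] at h
  have hculim : Tendsto (fun N => ℓu (w N)⁻¹) atTop (𝓝 (ℓu 0)) :=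
    (hu.continuousAt.tendsto).comp hσlim
  -- the two additive coordinates of the ray point are the `t`-branch coordinates at `T σ_N`
  have hcoordx : ∀ᶠ N : ℕ in atTop, x' N 0 = ((T (w N)⁻¹) ^ e)⁻¹ ∧
      x' N 1 = Φ₁ (T (w N)⁻¹) / (T (w N)⁻¹) ^ N₀ := by
    filter_upwards [hσmem] with N hN
    obtain ⟨-, -, h1, h2, -, -⟩ := hlink _ hN.1 hN.2
    rw [h1, h2, hw_inv_pow]
    exact ⟨by simp [x'], by simp [x']⟩
  -- the relation between the two additive coordinates holds at every late ray point
  have hR₃x : ∀ᶠ N : ℕ in atTop, MvPolynomial.aeval (x' N) R₃ = 0 := by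
    filter_upwards [hσmem, hcoordx] with N hN hNx
    obtain ⟨hT1, hT2, -, -, -, -⟩ := hlink _ hN.1 hN.2
    have hvec : x' N = ![((T (w N)⁻¹) ^ e)⁻¹, Φ₁ (T (w N)⁻¹) / (T (w N)⁻¹) ^ N₀] := by
      funext i; fin_cases i
      · simpa using hNx.1
      · simpa using hNx.2
    rw [hvec]
    exact hR₃ _ hT1 hT2
  -- a set of naturals on which an `atTop`-eventual property fails is finite
  have hfin_of_eventually : ∀ {P : ℕ → Prop}, (∀ᶠ N in atTop, P N) → Set.Finite {N | ¬ P N} := by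
    intro P hP
    rwa [← Nat.cofinite_eq_atTop, Filter.eventually_cofinite] at hP
  /- ### Step 4: CONSTANT exponential coordinates (`rayHits_finite_of_constLogs`) -/
  by_cases hconst : ∀ᶠ t in 𝓝 (0 : ℂ), ℓ₀ t = ℓ₀ 0 ∧ ℓ₁ t = ℓ₁ 0
  · have hℓconst : ∀ᶠ N : ℕ in atTop, ℓu (w N)⁻¹ = ℓ₀ 0 ∧ ℓv (w N)⁻¹ = ℓ₁ 0 := by
      filter_upwards [htlim.eventually hconst, hσmem] with N hN hNmem
      obtain ⟨-, -, -, -, h5, h6⟩ := hlink _ hNmem.1 hNmem.2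
      exact ⟨by rw [← h5]; exact hN.1, by rw [← h6]; exact hN.2⟩
    exact rayHits_finite_of_constLogs e A g ℓu ℓv (ℓ₀ 0) (ℓ₁ 0) R₃ hℓconst hα₀ hα₁ hR₃0 hR₃x
  /- ### Step 5: NON-CONSTANT exponential coordinates -/
  by_cases hlin : ∃ (β : ℂ) (G : ℂ → ℂ), AnalyticAt ℂ G 0 ∧
      ∀ t : ℂ, 0 < ‖t‖ → ‖t‖ < r → Φ₁ t / t ^ N₀ = β * (t ^ e)⁻¹ + G t
  swap
  · -- non-linear jet: atom A3
    exact hA3 ⟨W', hW', hdim', hbrW'⟩ ⟨R₁, hR₁0, hR₁⟩ ⟨R₂, hR₂0, hR₂⟩ ⟨R₃, hR₃0, hR₃⟩ ⟨R₄, hR₄0, hR₄⟩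
      ⟨R₅, hR₅0, hR₅⟩ ⟨R₆, hR₆0, hR₆⟩ hΦ₁alg hα₀ hα₁ hℓ₀alg hℓ₁alg hlin hconst
  obtain ⟨β, G, hG, hjet⟩ := hlin
  -- linear jet: `A = β X^e + a₀`, so the slope `β` is algebraic (the only use of `W` in this step)
  obtain ⟨a₀, hAeq⟩ := linearJet_normalForm hρ hg hu hv hT hT0 hG hlink hjet
  have hβalg : IsAlgebraic ℚ β :=
    cusp_slope_isAlgebraic_of_eq_linearJet W hW hdim s e A g ℓu ℓv ρ he hρ hg hg0 hu hv hbr hAeq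
  exact rayHits_finite_linearJet e N₀ A g ℓu ℓv T ℓ₀ ℓ₁ Φ₁ G ρ r β he hρ hr hg hg0 hu hv hT hT0 h₀ h₁ hΦ₁
    htr hrat hreal hlink ⟨W', hW', hdim', hbrW'⟩ ⟨R₁, hR₁0, hR₁⟩ ⟨R₂, hR₂0, hR₂⟩ ⟨R₃, hR₃0, hR₃⟩
    ⟨R₄, hR₄0, hR₄⟩ ⟨R₅, hR₅0, hR₅⟩ ⟨R₆, hR₆0, hR₆⟩ hΦ₁alg hα₀ hα₁ hℓ₀alg hℓ₁alg hG hjet hβalg hconst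
    hDeep
    (hA2 G β ⟨W', hW', hdim', hbrW'⟩ ⟨R₁, hR₁0, hR₁⟩ ⟨R₂, hR₂0, hR₂⟩ ⟨R₃, hR₃0, hR₃⟩ ⟨R₄, hR₄0, hR₄⟩
      ⟨R₅, hR₅0, hR₅⟩ ⟨R₆, hR₆0, hR₆⟩ hΦ₁alg hα₀ hα₁ hℓ₀alg hℓ₁alg hG hjet)
    (fun q m₀ m₁ => hA1 G β q m₀ m₁ ⟨W', hW', hdim', hbrW'⟩ ⟨R₁, hR₁0, hR₁⟩ ⟨R₂, hR₂0, hR₂⟩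
      ⟨R₃, hR₃0, hR₃⟩ ⟨R₄, hR₄0, hR₄⟩ ⟨R₅, hR₅0, hR₅⟩ ⟨R₆, hR₆0, hR₆⟩ hΦ₁alg hα₀ hα₁ hℓ₀alg hℓ₁alg
      hG hjet)

end Summit.Schanuel.Schanuel.Cruxes.SparsityTwo.CuspGermSchneiderSparsity
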